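/-
Copyright (c) 2026 the pub-hodgecm-mathlib formalisation cell (harness21).  Prover seat hodgecm-mathlib-LH5-p04 (g5): (C5)′ «TorusAll» sequel (LH4-plan (g7) deal ≈17:03Z):
the case-(e) count DISCHARGED; 2026-09-02.
-/
import Literature.NumberTheory.Automorphic.UnitaryThreeTraceTorusJZeroLetters               -- ★ p852152∕p852162 (this seat): the letters block (explicit witnesses)
import Literature.NumberTheory.Automorphic.UnitaryThreeBorelCosetCountJZeroHighTrace        -- ★ p852089 (LH4-p02 (g8)): `natCard_cosets_of_iff_norm_sub_le_high_trace` (the `j > m` near count, `ℓ ≥ 1`)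
import Literature.NumberTheory.Automorphic.UnitaryThreeBorelConjugateCongruencesJZeroEqualSizeTrace  -- ★ p852035 FILE 2 (LH4-p02): `v_eq_one_of_trace_mul_eq` (`|w₀| = 1`, 2-free)
import Literature.NumberTheory.Automorphic.UnitaryThreePHTowerPackageTrace                 -- ★ C2-C p852072 (LH5-p05): Prop. 8 numbers `…_of_rel`
import Literature.NumberTheory.Automorphic.UnitaryThreePHTowerIndexTrace                   -- ★ C2-B p852004: `inf_flickerHK_le_flickerPH0_of_rel`
import Literature.NumberTheory.Automorphic.UnitaryThreeTorusBlockElementsTrace             -- ★ F1 (LH3-p02): `v_eq_one_of_add_map_eq_one`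
import HarnessLib

/-!
# The case-(e) count of Flicker's Prop. 13 at the θ̄ = 0 TRACE torus literal — the `hce` binder of ★ `…CountJZeroTorusAllTrace` DISCHARGED
# (Flicker 1998 Prop. 13 (e) pp. 92–93; Rogawski 1990 Prop. 4.9.1)

Topic `NumberTheory/Automorphic`; namespace `Literature.NumberTheory.Automorphic.UnitaryGroup`.  THEOREMS ONLY (no `def`, no instance, no notation, no named fact, no `sorry`);
count-neutral; kernel lane `--supports stmt-HodgeConjecture-24833`.  Cell `pub/hodgecm-mathlib` (D-0151), crux H413 = `stmt-HodgeConjecture-24833`, LH4 board (D-UNR) list (5), (C5)′.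

WHAT.  ★ `UnitOrbitalIntegralInertCountJZeroTorusAll` (and its 2-free twin ★ p852186 `…TorusAllTrace`) carry ONE named gap as a binder: the case-(e) count `hce` of Prop. 13 —
at a level `m > N` with `M < 2m ≤ M + N`, `M − N = 2ℓ` even (so `ℓ ≥ 1`), IF the Borel criterion reads `p⁻¹tp ∈ H^K_m ⟺ |X·σX − C| ≤ |ϖ^{2m−N}|` (X-shape,
`X = κ(uσu)⁻¹ + (x + z) + r`, `C = r(s + r)`) THEN the coset count is `(q+1)²q^{2m+N−2}`.  In the trace frame this count IS available: ★ p852089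
`natCard_cosets_of_iff_norm_sub_le_high_trace` (LH4-p02) counts the near cells with precision `j ≤ m + ℓ` (here `j = 2m − N`, and `2m ≤ M + N ⟺ j ≤ m + ℓ`) from the
criterion in the letters `(κ, d, e, y₀, γ)`.  THIS FILE re-letters the X-shape criterion into that currency at the literal — `e := w₀`, `κw₀ + y₀ = z + r` (★ p852162 `hc0`),
`|w₀| = 1` (★ FILE 2 `v_eq_one_of_trace_mul_eq`, from `|r(s+r)| = |ϖ^{M−N}| < 1`), `γ := r(s+r)∕ϖ^{2ℓ}` (a `σ`-fixed unit), `d := σa₀ − a₀` (T1's skew unit) — discharges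
Prop. 8 by ★ C2-B∕C2-C (`F = q^m`), and does the ℕ exponent bookkeeping `q^m·q^{m−1}(q+1)·q^{(m−ℓ)−(j−2ℓ)}·q^{(m−ℓ)−1}(q+1) = (q+1)²q^{2m+N−2}`.
HEAD **`hce_traceTorus_jzero_of_rel`**: its TYPE is the `hce` binder of ★ p852186 `finsum_natCard_fixedPoints_traceTorusOne_eq_phiZero` token for token (hypotheses ⊆ that head's
binders, same names), so the θ̄ = 0 VALUE file passes `(hce := hce_traceTorus_jzero_of_rel σ hJ hd h2 hσO hy hzv hz hc u hu hb hbv hx₁ hx₂ hx₃ t hN hN₁ hN₂ h hq ha₀)` — NOTE `t` is EXPLICIT and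
`hte`∕`htH` are NOT taken: the count needs only the CRITERION, not the literal (the literal enters through the letters `b, xᵢ` of the criterion's shape)
and carries NO case-(e) binder.  HONEST READER LABEL: count-neutral; under (R0)∕D1 this cell (`ℓ ≥ 1`) is residue-characteristic-free (LH4-p01 CENSUS-Large (6), LH4-p02 High census:
no residual quadratic at `ℓ ≥ 1`) — the value is print's; pays no organ, opens no road ((D-UNR) PRINT by D74′); HC_CM is proved only modulo the 7 printed citations (2 remaining named inputs:
hLiu418 = stmt-HodgeConjecture-24832, h413 = stmt-HodgeConjecture-24833) until rung 0 closes.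

## References
* [Flicker1998UnitaryFL] Y. Z. Flicker, *Elementary proof of the fundamental lemma for a unitary group*, Canad. J. Math. 50 (1998), Prop. 13 (e) pp. 92–93.
* [Rogawski1990] J. D. Rogawski, *Automorphic Representations of Unitary Groups in Three Variables* (1990), §4.9 Prop. 4.9.1 p. 55.
-/

set_option autoImplicit false

open scoped MatrixGroups WithZero Valued
open Matrix

namespace Literature.NumberTheory.Automorphic

namespace UnitaryGroup

open Literature.NumberTheory.Automorphic.HermitianLattice (UnramifiedLocalConjDatum)
open IsLocalRing

variable {K : Type*} [Field K] [Valued K ℤᵐ⁰] {ϖ : K} (σ : K →+* K) {J : Matrix (Fin 3) (Fin 3) K}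

section Count

variable [IsDiscreteValuationRing 𝒪[K]] [Finite (ResidueField 𝒪[K])] [IsAdicComplete (maximalIdeal 𝒪[K]) 𝒪[K]]

/-- ℕ bookkeeping of the case-(e) count: with `j = 2m − N`, `M − N = 2ℓ`, `M < 2m ≤ M + N`, `N < m`:
`q^m·((q^{m−1}(q+1))·(q^{(m−ℓ)−(j−2ℓ)}·(q^{(m−ℓ)−1}(q+1)))) = (q+1)²·q^{2m+N−2}`. [cite: Flicker1998UnitaryFL, Prop. 13 (e) p. 93] -/
theorem case_e_exponent_bookkeeping (q : ℕ) {m N M ℓ j : ℕ} (hNm : N < m) (hM2 : M < 2 * m) (h2M : 2 * m ≤ M + N) (hℓ : M - N = 2 * ℓ) (hj : j = 2 * m - N) :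
    q ^ m * ((q ^ (m - 1) * (q + 1)) * (q ^ ((m - ℓ) - (j - 2 * ℓ)) * (q ^ ((m - ℓ) - 1) * (q + 1)))) = (q + 1) ^ 2 * q ^ (2 * m + N - 2) := by
  have hsum : m + (m - 1) + ((m - ℓ) - (j - 2 * ℓ)) + ((m - ℓ) - 1) = 2 * m + N - 2 := by omega
  calc q ^ m * ((q ^ (m - 1) * (q + 1)) * (q ^ ((m - ℓ) - (j - 2 * ℓ)) * (q ^ ((m - ℓ) - 1) * (q + 1))))
      = (q + 1) ^ 2 * (q ^ m * q ^ (m - 1) * q ^ ((m - ℓ) - (j - 2 * ℓ)) * q ^ ((m - ℓ) - 1)) := by ring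
    _ = (q + 1) ^ 2 * q ^ (m + (m - 1) + ((m - ℓ) - (j - 2 * ℓ)) + ((m - ℓ) - 1)) := by rw [← pow_add, ← pow_add, ← pow_add]
    _ = (q + 1) ^ 2 * q ^ (2 * m + N - 2) := by rw [hsum]

set_option maxHeartbeats 1600000 in
/-- **THE CASE-(e) COUNT AT THE θ̄ = 0 TRACE TORUS LITERAL** — the `hce` binder of ★ `finsum_natCard_fixedPoints_traceTorusOne_eq_phiZero` (★ p852186) DISCHARGED: for every
level `m` with `N < m`, `N ≤ N₊`, `M < 2m ≤ M + N`, `M − N` even (`M = max N₁ N₂`), the X-shape criterion implies the count `(q+1)²q^{2m+N−2}` (★ High p852089 at `j = 2m − N`,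
`ℓ = (M − N)∕2 ≥ 1`, letters re-keyed at the literal).  See the module docstring. [cite: Flicker1998UnitaryFL, Prop. 13 (e) pp. 92–93] [cite: Rogawski1990, §4.9 Prop. 4.9.1 p. 55] -/
theorem hce_traceTorus_jzero_of_rel (hJ : J = (StdForm.antidiagonal 3).over K) (hd : UnramifiedLocalConjDatum σ ϖ) (h2 : (2 : K) ≠ 0)
    (hσO : ∀ y : 𝒪[K], (σ.comp 𝒪[K].subtype) y ∈ 𝒪[K]) {y z : K} (hy : Valued.v y = 1) (hzv : Valued.v z ≤ 1) (hz : z + σ z + y * σ y = 0)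
    {c : ↥(unitaryGroupOfForm σ J)} (hc : ((c : GL (Fin 3) K) : Matrix (Fin 3) (Fin 3) K) = !![1, 0, 0; 0, -1, 0; 0, 0, 1])
    (u : ℕ → ↥(unitaryGroupOfForm σ J))
    (hu : ∀ m, ((u m : GL (Fin 3) K) : Matrix (Fin 3) (Fin 3) K) = !![ϖ ^ m, y, z * (ϖ ^ m)⁻¹; 0, 1, -σ y * (ϖ ^ m)⁻¹; 0, 0, (ϖ ^ m)⁻¹])
    {b : K} (hb : b + σ b = 1) (hbv : Valued.v b ≤ 1) {x₁ x₂ x₃ : K} (hx₁ : σ x₁ * x₁ = 1) (hx₂ : σ x₂ * x₂ = 1) (hx₃ : σ x₃ * x₃ = 1)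
    (t : ↥(unitaryGroupOfForm σ J))
    {N N₁ N₂ Np : ℕ} (hN : Valued.v (x₁ - x₃) = Valued.v (ϖ ^ N)) (hN₁ : Valued.v (x₁ - x₂) = Valued.v (ϖ ^ N₁)) (hN₂ : Valued.v (x₃ - x₂) = Valued.v (ϖ ^ N₂))
    (h : (N₁ < N ∧ N₂ = N₁ ∧ Np = N₁ ∧ Valued.v ((x₁ - x₂) * σ b + (x₃ - x₂) * b) = Valued.v (ϖ ^ N₁)) ∨
      (N ≤ N₁ ∧ N ≤ Np ∧ Valued.v ((x₁ - x₂) * σ b + (x₃ - x₂) * b) ≤ Valued.v (ϖ ^ N)))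
    {q : ℕ} (hq : Nat.card (ResidueField 𝒪[K]) = q ^ 2)
    {a₀ : 𝒪[K]} (ha₀ : IsUnit (((σ.comp 𝒪[K].subtype).codRestrict 𝒪[K] hσO) a₀ - a₀)) :
    ∀ m, N < m → N ≤ Np → max N₁ N₂ < 2 * m → 2 * m ≤ max N₁ N₂ + N → (max N₁ N₂ - N) % 2 = 0 →
      (∀ p ∈ flickerPH σ J c, ∀ u' x w : K,
        ((p : GL (Fin 3) K) : Matrix (Fin 3) (Fin 3) K) = !![u', 0, u' * x; 0, w, 0; 0, 0, (σ u')⁻¹] →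
          (p⁻¹ * t * p ∈ flickerHK σ J c (u m) ↔
            Valued.v (((σ b)⁻¹ * (u' * σ u')⁻¹ + (x + z) + ((x₃ - x₂) * (-(y * σ y)) * (b * x₂ + σ b * x₁) / ((x₁ - x₃) * x₂))) * σ ((σ b)⁻¹ * (u' * σ u')⁻¹ + (x + z) + ((x₃ - x₂) * (-(y * σ y)) * (b * x₂ + σ b * x₁) / ((x₁ - x₃) * x₂))) -
              ((x₃ - x₂) * (-(y * σ y)) * (b * x₂ + σ b * x₁) / ((x₁ - x₃) * x₂)) * ((-(y * σ y)) + ((x₃ - x₂) * (-(y * σ y)) * (b * x₂ + σ b * x₁) / ((x₁ - x₃) * x₂)))) ≤ Valued.v (ϖ ^ (2 * m - N)))) →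
      Nat.card {w : ↥(flickerPH σ J c) ⧸ (flickerHK σ J c (u m)).subgroupOf (flickerPH σ J c) //
        ((Quotient.out w : ↥(flickerPH σ J c)) : ↥(unitaryGroupOfForm σ J))⁻¹ * t * (Quotient.out w : ↥(flickerPH σ J c)) ∈ flickerHK σ J c (u m)} =
        (q + 1) ^ 2 * q ^ (2 * m + N - 2) := by
  intro m hNm hNNp hM2 h2M hpar hcrit
  have hσσ := hd.σσ
  have hϖ0 : ϖ ≠ 0 := hd.ϖ_ne_zero
  have vle : ∀ {i j : ℕ}, Valued.v (ϖ ^ i) ≤ Valued.v (ϖ ^ j) ↔ j ≤ i := fun {i j} => by rw [hd.v_pow, hd.v_pow, WithZero.exp_le_exp]; omega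
  have vlt : ∀ {i j : ℕ}, Valued.v (ϖ ^ i) < Valued.v (ϖ ^ j) ↔ j < i := fun {i j} => by rw [hd.v_pow, hd.v_pow, WithZero.exp_lt_exp]; omega
  -- `|b| = 1`, `s = −yσy`
  have hbv1 : Valued.v b = 1 := (v_eq_one_of_add_map_eq_one σ hd.vσ hbv hb).1
  have hσbv : Valued.v (σ b) = 1 := by rw [hd.vσ]; exact hbv1
  have hσs : σ (-(y * σ y)) = (-(y * σ y)) := by rw [map_neg, map_mul, hσσ, mul_comm]
  have hsv : Valued.v (-(y * σ y)) = 1 := by rw [Valuation.map_neg, map_mul, hd.vσ, hy, mul_one]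
  -- the letters block (explicit witnesses)
  obtain ⟨hκ, htr, hrv, -, -, -, hr, hc0, hσw₀, hσy₀, -, -, hreg⟩ :=
    traceTorus_jzero_letters_explicit σ hd (z := z) (Np := Np) hb hbv1 hσs hsv hx₁ hx₂ hx₃ hN hN₁ hN₂ h
  -- the regime: type B (type A has `Np < N ≤ Np`, absurd), `1 ≤ N`, `M = N + 2ℓ`, `ℓ ≥ 1`
  rcases hreg with hA | ⟨-, hNM, -, hCeq, -⟩
  · exfalso; omega
  have hN1 : 1 ≤ N := by omega
  have hCv := hCeq hN1
  obtain ⟨ℓ, hℓ⟩ : ∃ ℓ : ℕ, max N₁ N₂ - N = 2 * ℓ := ⟨(max N₁ N₂ - N) / 2, by omega⟩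
  have hℓ1 : 1 ≤ ℓ := by omega
  have hm : 1 ≤ m := by omega
  -- names for the letters
  set κ : K := (σ b)⁻¹ with hκdef
  set s : K := (-(y * σ y)) with hsdef
  set r : K := ((x₃ - x₂) * (-(y * σ y)) * (b * x₂ + σ b * x₁) / ((x₁ - x₃) * x₂)) with hrdef
  have htr0 : κ + σ κ ≠ 0 := fun h0 => by rw [h0, map_zero] at htr; exact zero_ne_one htr
  have hσtr : σ (κ + σ κ) = κ + σ κ := by rw [map_add, hσσ, add_comm]
  -- `r` and `C = r(s+r)` are `σ`-fixed; `γ := C∕ϖ^{2ℓ}` is a `σ`-fixed unit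
  have hσr : σ r = r := by
    have e1 : σ r * (κ + σ κ) = r * (κ + σ κ) := by
      have := congrArg σ hr
      rw [map_mul, hσtr, map_add, map_mul, map_mul, hσσ, hσσ] at this
      rw [this, hr]; ring
    exact mul_right_cancel₀ htr0 e1
  have hσC : σ (r * (s + r)) = r * (s + r) := by rw [map_mul, map_add, hσr, hσs]
  have hC2ℓ : Valued.v (r * (s + r)) = Valued.v (ϖ ^ (2 * ℓ)) := by rw [hCv, hℓ]
  have hϖ2ℓ : (ϖ ^ (2 * ℓ) : K) ≠ 0 := pow_ne_zero _ hϖ0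
  set γ : K := r * (s + r) * (ϖ ^ (2 * ℓ))⁻¹ with hγdef
  have hCγ : r * (s + r) = ϖ ^ (2 * ℓ) * γ := by rw [hγdef]; field_simp
  have hγ : Valued.v γ = 1 := by rw [hγdef, map_mul, map_inv₀, hC2ℓ, mul_inv_cancel₀ ((Valuation.ne_zero_iff _).2 hϖ2ℓ)]
  have hσγ : σ γ = γ := by rw [hγdef, map_mul, map_inv₀, hσC, map_pow, hd.σϖ]
  -- `e := w₀` is a unit (★ FILE 2, 2-free), `|y₀| ≤ 1`
  set w₀ : K := (z + r + σ (z + r)) / (κ + σ κ) with hw₀def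
  set y₀ : K := z + r - κ * w₀ with hy₀def
  have hw₀eq : (κ + σ κ) * w₀ = s + 2 * r := by
    rw [hw₀def, ← mul_div_assoc, mul_div_cancel_left₀ _ htr0, map_add, hσr, hsdef]
    linear_combination hz
  have hClt : Valued.v (r * (s + r)) < 1 := by
    rw [hC2ℓ]
    calc Valued.v (ϖ ^ (2 * ℓ)) < Valued.v (ϖ ^ 0) := by rw [vlt]; omega
      _ = 1 := by rw [pow_zero, map_one]
  have hw₀v : Valued.v w₀ = 1 := v_eq_one_of_trace_mul_eq σ htr hsv hw₀eq hClt
  have hy₀v : Valued.v y₀ ≤ 1 := by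
    rw [hy₀def]
    refine (Valuation.map_sub _ _ _).trans (max_le ((Valuation.map_add _ _ _).trans (max_le hzv (hrv hNNp))) ?_)
    rw [map_mul, hκ, hw₀v, one_mul]
  -- the skew unit `d := σa₀ − a₀`
  have hdv : Valued.v (σ (a₀ : K) - a₀) = 1 := by
    have hu := (Valuation.Integers.isUnit_iff_valuation_eq_one (Valuation.integer.integers (Valued.v : Valuation K ℤᵐ⁰))).1 ha₀
    exact hu
  have hσd : σ (σ (a₀ : K) - a₀) = -(σ (a₀ : K) - a₀) := by rw [map_sub, hσσ]; ring
  -- Prop. 8's numbers (★ C2-B ∕ C2-C)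
  haveI := finite_quotient_flickerHK_of_rel σ hJ hd h2 hy hzv hz hσO m (hu m) hc hq ha₀
  have hSN := inf_flickerHK_le_flickerPH0_of_rel σ hJ hd h2 hy hzv hz m (hu m) hc
  have hfib := natCard_fibre_flickerPHRho_eq_of_rel σ hJ hd h2 hy hzv hz hσO m (hu m) hc hq ha₀
  -- the criterion re-lettered into the High currency
  have hcrit' : ∀ p ∈ flickerPH σ J c, ∀ u' x w : K,
      ((p : GL (Fin 3) K) : Matrix (Fin 3) (Fin 3) K) = !![u', 0, u' * x; 0, w, 0; 0, 0, (σ u')⁻¹] →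
        (p⁻¹ * t * p ∈ flickerHK σ J c (u m) ↔
          Valued.v ((κ * (u' * σ u')⁻¹ + x + (κ * w₀ + y₀)) * σ (κ * (u' * σ u')⁻¹ + x + (κ * w₀ + y₀)) - ϖ ^ (2 * ℓ) * γ) ≤ Valued.v (ϖ ^ (2 * m - N))) := by
    intro p hp u' x w hpm
    have hX : κ * (u' * σ u')⁻¹ + x + (κ * w₀ + y₀) = κ * (u' * σ u')⁻¹ + (x + z) + r := by rw [← hc0]; ring
    rw [hX, ← hCγ]
    exact hcrit p hp u' x w hpm
  -- COUNT (★ High p852089) at `j = 2m − N`, precision window `2ℓ < j ≤ m + ℓ`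
  have hcount := natCard_cosets_of_iff_norm_sub_le_high_trace σ hJ hd h2 hσO (j := 2 * m - N) hm hℓ1 (by omega) (by omega) hc
    hκ htr hdv hσd hw₀v hσw₀ hy₀v hσy₀ hγ hσγ hcrit' hq ha₀ hSN hfib
  rw [hcount]
  exact case_e_exponent_bookkeeping q hNm hM2 h2M hℓ rfl

end Count

end UnitaryGroup

end Literature.NumberTheory.Automorphic
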